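import Mathlib
import Summits.Ventures.LatticeQCDFlow.TrivializingMaps.GradedTheoremA
import Summits.Ventures.LatticeQCDFlow.TrivializingMaps.DefectLogWeight
import HarnessLib

/-!
# Summing Lüscher's flow-action series, II: manifold sup bounds for the Casimir-graded series

HONEST FRAMING: exact (Metropolis-corrected) sampling algorithms for lattice gauge theory; figures
of merit are autocorrelation/cost numbers at stated couplings and volumes; no continuum-physics claim.
Statements about the explicit Casimir-graded solution `gradedSk B k` (`GradedSeries`) of Lüscher's recursion
(4.12)–(4.15) for the SU(n) Wilson plaquette action on a FINITE periodic lattice `(ℤ/L)^d`.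

M. Lüscher, CMP 293 (2010) 899–919 [Luscher2010Trivializing], §4.3–§4.5.  THEOREM A (`GradedTheoremA`,
theory-1) controls the LINK GRADIENTS of `S̃^{(k)} = gradedSk B k` through the link masses,
`N_{G_k}(e) ≤ N₀ θ₁^k` (`mass_pack_le`).  To SUM the series `∑_k t^k S̃^{(k)}` as a flow action
(`SeriesSummation.luscherL_tSeries_eq`) one needs manifold majorants for the VALUES and for the REPEATED
link derivatives `∂^a_e ∂^a_e S̃^{(k)}` as well.  This file supplies them, from the same masses:

* §1 `‖1 ⊗ B‖ ≤ ‖B‖` (`norm_toE_liftR_le`, the mirror image of `TensorShift.norm_toE_liftL_le`);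
  no definitions are introduced (right slices are written out);
* §2 every joint Casimir mode is bounded by the generator norm, `√(m_e) ≤ τ_e := ∑ₐ ‖T_a^{σ,e}‖`
  (`sqrt_mode_le_genNorm`: an eigenvalue of `∑ₐ T_a†T_a` is at most `(∑ₐ ‖T_a‖)²`);
* §3 the generator norms of the sum system add (`genNorm_sum_le`), so along the generations
  `τ_e(S_i) ≤ (k+1) τ_*` and the weights obey `√((m_i)_e) ≤ (k+1) τ_*` (`wt_pack_le`);
* §4 the bounds on `SU(n)^E`, every volume `L`, every basis `B`, `n ≠ 0`:
  values `|S̃^{(k)}(ιU)| ≤ (n/4)^{-1/2} · #E · N₀ θ₁^k` (`abs_gradedSk_le` — extensive, as it must be),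
  gradients `|∂^a_e S̃^{(k)}(ιU)| ≤ N₀ θ₁^k` (`abs_linkDeriv_gradedSk_le`, THEOREM A restated), repeated
  derivatives `|∂^a_e∂^a_e S̃^{(k)}(ιU)| ≤ (k+1) τ_* N₀ θ₁^k` (`abs_linkDeriv_linkDeriv_gradedSk_le`).

All constants depend on `d, n, B` only, except the honest volume factor `#E` in the value bound; the RATE is
`θ₁ = θ₁(d, n, B)` throughout, so every series has radius `≥ θ₁⁻¹` in `t`, uniformly in `L`.
Authored by the pub-lqcd lean-2 seat (cell lqcd-flow, FANOUT row 31 GEN-4). Tags: [ours] = venture work.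
-/

noncomputable section

namespace Summit.Ventures.LatticeQCDFlow.TrivializingMaps

open scoped ComplexConjugate Matrix Matrix.Norms.Frobenius InnerProductSpace ContDiff
open Literature.MathematicalPhysics.QuantumFieldTheory
open Literature.MathematicalPhysics.QuantumFieldTheory.Luscher2010
open SlotRepresentation SlotCasimir SlotHilbert JointGrading CasimirGrading PlaquetteData SlotTensor
  TensorShift RankOne Vertex

/-! ## §1. `‖1 ⊗ B‖ ≤ ‖B‖` -/

namespace TensorShift

variable {n : ℕ} {σ₁ σ₂ : Type*} [Fintype σ₁] [Fintype σ₂] [DecidableEq σ₁] [DecidableEq σ₂]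

/-- `‖v‖² = ∑_{I₁} ‖v_{(I₁, ·)}‖²` (right slices; the mirror image of `norm_sq_eq_sum_slice`; the slice is
written out, `(v_{(I₁,·)})_{I₂} = v_{(I₁,I₂)}`, to keep this file definition-free). [folklore] -/
theorem norm_sq_eq_sum_sliceR (v : SlotSpace (σ₁ ⊕ σ₂) n) :
    ‖v‖ ^ 2 = ∑ I₁, ‖(WithLp.toLp 2 fun I₂ => WithLp.ofLp v (Sum.elim I₁ I₂) : SlotSpace σ₂ n)‖ ^ 2 := by
  rw [norm_sq_eq_sum, sum_sumArrow (fun I => ‖WithLp.ofLp v I‖ ^ 2)]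
  refine Finset.sum_congr rfl fun I₁ _ => ?_
  rw [norm_sq_eq_sum]

/-- `1 ⊗ B` acts slice-wise: `((1 ⊗ B) v)_{(I₁,I₂)} = (B · v_{(I₁,·)})_{I₂}`. [folklore] -/
theorem ofLp_toE_liftR_apply (B : Matrix (σ₂ → Fin n) (σ₂ → Fin n) ℂ) (v : SlotSpace (σ₁ ⊕ σ₂) n)
    (I₁ : σ₁ → Fin n) (I₂ : σ₂ → Fin n) :
    WithLp.ofLp (toE (liftR (σ₁ := σ₁) B) v) (Sum.elim I₁ I₂) =
      WithLp.ofLp (toE B (WithLp.toLp 2 fun J₂ => WithLp.ofLp v (Sum.elim I₁ J₂) : SlotSpace σ₂ n)) I₂ := by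
  rw [Matrix.ofLp_toEuclideanCLM, Matrix.ofLp_toEuclideanCLM, Matrix.mulVec, dotProduct, sum_sumArrow,
    Matrix.mulVec, dotProduct]
  rw [Finset.sum_comm]
  refine Finset.sum_congr rfl fun J₂ _ => ?_
  simp only [liftR_apply, elim_comp_inl', elim_comp_inr', Matrix.one_apply, ite_mul, one_mul, zero_mul,
    Finset.sum_ite_eq, Finset.mem_univ, if_true]

/-- Right slices of `(1 ⊗ B) v` are `B` applied to right slices. [folklore] -/
theorem sliceR_toE_liftR (B : Matrix (σ₂ → Fin n) (σ₂ → Fin n) ℂ) (v : SlotSpace (σ₁ ⊕ σ₂) n)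
    (I₁ : σ₁ → Fin n) :
    (WithLp.toLp 2 fun I₂ => WithLp.ofLp (toE (liftR (σ₁ := σ₁) B) v) (Sum.elim I₁ I₂) : SlotSpace σ₂ n) =
      toE B (WithLp.toLp 2 fun I₂ => WithLp.ofLp v (Sum.elim I₁ I₂) : SlotSpace σ₂ n) := by
  apply (WithLp.ofLp_injective 2).eq_iff.1
  funext I₂
  exact ofLp_toE_liftR_apply B v I₁ I₂

/-- **`‖1 ⊗ B‖ ≤ ‖B‖`**: lifting an old-system operator to the sum space does not increase its norm.
[folklore] -/
theorem norm_toE_liftR_le (B : Matrix (σ₂ → Fin n) (σ₂ → Fin n) ℂ) :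
    ‖toE (liftR (σ₁ := σ₁) B)‖ ≤ ‖toE B‖ := by
  refine ContinuousLinearMap.opNorm_le_bound _ (norm_nonneg _) fun v => ?_
  have h : ‖toE (liftR (σ₁ := σ₁) B) v‖ ^ 2 ≤ (‖toE B‖ * ‖v‖) ^ 2 := by
    rw [norm_sq_eq_sum_sliceR, mul_pow, norm_sq_eq_sum_sliceR v, Finset.mul_sum]
    refine Finset.sum_le_sum fun I₁ _ => ?_
    rw [sliceR_toE_liftR, ← mul_pow]
    exact pow_le_pow_left₀ (norm_nonneg _) (ContinuousLinearMap.le_opNorm _ _) 2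
  exact (pow_le_pow_iff_left₀ (norm_nonneg _) (by positivity) two_ne_zero).1 h

variable {E : Type*} [DecidableEq E] (lnk₁ : σ₁ → E) (pol₁ : σ₁ → Bool) (lnk₂ : σ₂ → E) (pol₂ : σ₂ → Bool)
  (B : SuBasis n)

/-- `‖Z a‖ ≤ ‖T_a^{S,e}‖` for the lifted old generators. [ours] -/
theorem norm_genR_le (e : E) (a : B.ι) :
    ‖genR (σ₁ := σ₁) lnk₂ pol₂ B e a‖ ≤ ‖genCLM lnk₂ pol₂ e (B.T a)‖ :=
  norm_toE_liftR_le _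

/-- **The generator norms of a sum system add**: `τ_e(Q ⊕ S) ≤ τ_e(Q) + τ_e(S)`. [ours] -/
theorem genNorm_sum_le (e : E) :
    genNorm (Sum.elim lnk₁ lnk₂) (Sum.elim pol₁ pol₂) B e ≤ genNorm lnk₁ pol₁ B e + genNorm lnk₂ pol₂ B e := by
  unfold genNorm
  rw [← Finset.sum_add_distrib]
  refine Finset.sum_le_sum fun a _ => ?_
  rw [genCLM_sum_eq]
  exact (norm_add_le _ _).trans (add_le_add (norm_genL_le (σ₂ := σ₂) lnk₁ pol₁ B e a)
    (norm_genR_le (σ₁ := σ₁) lnk₂ pol₂ B e a))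

end TensorShift

/-! ## §2. Joint Casimir modes are bounded by the generator norm -/

namespace SlotHilbert

variable {n : ℕ} {σ : Type*} [Fintype σ] [DecidableEq σ] {E : Type*} [DecidableEq E]
  (lnk : σ → E) (pol : σ → Bool) (B : SuBasis n)

/-- **A joint Casimir mode is at most the square of the generator norm**: `m_e ≤ (∑ₐ ‖T_a^{σ,e}‖)²`
(`m_e` is an eigenvalue of `C^{σ,e} = ∑ₐ (T_a)† T_a`; on an eigenvector `v`,
`m_e ‖v‖² = ∑ₐ ‖T_a v‖² ≤ (∑ₐ ‖T_a‖)² ‖v‖²`). [folklore] -/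
theorem mode_re_le_genNorm_sq (m : Modes (casimirFamily lnk pol B)) (e : E) :
    (m e : ℂ).re ≤ genNorm lnk pol B e ^ 2 := by
  obtain ⟨v, hv⟩ := Module.End.HasEigenvalue.exists_hasEigenvector
    (f := (casimirFamily lnk pol B e : SlotSpace σ n →ₗ[ℂ] SlotSpace σ n)) (m e).property
  have hv0 : v ≠ 0 := hv.2
  have hre : (m e : ℂ) = (((m e : ℂ).re : ℝ) : ℂ) :=
    mode_eq_re _ (fun e' => isSelfAdjoint_casimirCLM lnk pol B e') m e
  have h1 : (casimirFamily lnk pol B e : SlotSpace σ n →ₗ[ℂ] SlotSpace σ n) v = (m e : ℂ) • v :=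
    hv.apply_eq_smul
  rw [ContinuousLinearMap.coe_coe] at h1
  have hC : casimir (fun a => genCLM lnk pol e (B.T a)) v = (((m e : ℂ).re : ℝ) : ℂ) • v := by
    rw [← casimirCLM_eq_casimir, ← hre]
    exact h1
  have h2 : (m e : ℂ).re * ‖v‖ ^ 2 = ∑ a, ‖genCLM lnk pol e (B.T a) v‖ ^ 2 := by
    rw [← re_inner_casimir_of_eigen _ hC, re_inner_casimir_self]
  have h3 : ∑ a, ‖genCLM lnk pol e (B.T a) v‖ ^ 2 ≤ (genNorm lnk pol B e) ^ 2 * ‖v‖ ^ 2 := by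
    calc ∑ a, ‖genCLM lnk pol e (B.T a) v‖ ^ 2 ≤ ∑ a, (‖genCLM lnk pol e (B.T a)‖ * ‖v‖) ^ 2 :=
          Finset.sum_le_sum fun a _ =>
            pow_le_pow_left₀ (norm_nonneg _) (ContinuousLinearMap.le_opNorm _ _) 2
      _ = (∑ a, ‖genCLM lnk pol e (B.T a)‖ ^ 2) * ‖v‖ ^ 2 := by
          rw [Finset.sum_mul]; exact Finset.sum_congr rfl fun a _ => by ring
      _ ≤ (genNorm lnk pol B e) ^ 2 * ‖v‖ ^ 2 := by
          refine mul_le_mul_of_nonneg_right ?_ (sq_nonneg _)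
          unfold genNorm
          exact Finset.sum_sq_le_sq_sum_of_nonneg fun a _ => norm_nonneg _
  have hv2 : 0 < ‖v‖ ^ 2 := by positivity
  exact le_of_mul_le_mul_right (h2.le.trans h3 |>.trans_eq (by ring)) hv2

/-- `√(m_e) ≤ τ_e = ∑ₐ ‖T_a^{σ,e}‖`. [folklore] -/
theorem sqrt_mode_le_genNorm (m : Modes (casimirFamily lnk pol B)) (e : E) :
    Real.sqrt (m e : ℂ).re ≤ genNorm lnk pol B e := by
  rw [← Real.sqrt_sq (genNorm_nonneg lnk pol B e)]
  exact Real.sqrt_le_sqrt (mode_re_le_genNorm_sq lnk pol B m e)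

end SlotHilbert

/-! ## §3. Generator norms and weights along the generations -/

namespace GradedSeries

open Finset

variable {d L n : ℕ} [NeZero L] (B : SuBasis n)

/-- **Linear growth of the generator norms**: every datum of generation `k` lives on a slot system with
`τ_e ≤ (k+1) τ_*` at every link (one plaquette system is tensored in per generation, `genNorm_sum_le`,
and each has `τ_e ≤ τ_*`, `genNorm_le_tauStar`). [ours] -/
theorem genNorm_pack_le (k : ℕ) (i : (pack (d := d) (L := L) B k).G.I) (e : Edge d L) :
    genNorm ((pack (d := d) (L := L) B k).G.lnk i) ((pack (d := d) (L := L) B k).G.pol i) B e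
      ≤ ((k : ℝ) + 1) * tauStar B := by
  induction k with
  | zero =>
      rw [Nat.cast_zero, zero_add, one_mul]
      exact genNorm_le_tauStar B _ false e
  | succ k ih =>
      obtain ⟨e₁, a, i₀, p, b, c, m'⟩ := i
      show genNorm ((pack (d := d) (L := L) B k).G.clnk i₀ p) ((pack (d := d) (L := L) B k).G.cpol i₀ b) B e
        ≤ _
      unfold Gen.clnk Gen.cpol
      refine (genNorm_sum_le _ _ _ _ B e).trans ?_
      have h1 := genNorm_le_tauStar B (plaqIdx (d := d) (L := L) p.1 p.2.1 p.2.2) b e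
      have h2 := ih i₀
      push_cast
      linarith

/-- **Linear growth of the weights**: `√((m_i)_e) ≤ (k+1) τ_*` for every datum of generation `k` and every
link. [ours] -/
theorem wt_pack_le (k : ℕ) (i : (pack (d := d) (L := L) B k).G.I) (e : Edge d L) :
    (pack (d := d) (L := L) B k).G.wt i e ≤ ((k : ℝ) + 1) * tauStar B :=
  (sqrt_mode_le_genNorm _ _ B _ e).trans (genNorm_pack_le B k i e)

/-! ## §4. Sup bounds on the field manifold -/

section Values

variable {B}
variable {σ : Type} [Fintype σ] [DecidableEq σ] (G : Gen (d := d) (L := L) B σ)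

omit [NeZero L] in
/-- `|termᵢ(ιU)| ≤ νᵢ`. [ours] -/
theorem Gen.abs_term_le (i : G.I) (U : GaugeConfig d L (Matrix.specialUnitaryGroup (Fin n) ℂ)) :
    |G.term i (WilsonFlow.coeConfig U)| ≤ G.nu i := by
  refine (abs_termF_coeConfig_le (G.lnk i) (G.pol i) (G.z i) (G.x i) (G.y i) U).trans (le_of_eq ?_)
  unfold Gen.nu; ring

/-- A live datum has total weight at least `√(n/4)`: `√(n/4) ≤ ∑ₑ √((mᵢ)_e)` (some `(mᵢ)_e ≠ 0`, and
non-zero modes are `≥ n/4`). [ours] -/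
theorem Gen.sqrt_quarter_le_sum_wt {i : G.I} (hi : i ∈ G.live) :
    Real.sqrt ((n : ℝ) / 4) ≤ ∑ e, G.wt i e := by
  have hc : G.cm i ≠ 0 := G.mem_live.1 hi
  obtain ⟨e₀, -, he₀⟩ := Finset.exists_ne_zero_of_sum_ne_zero hc
  have h0 : 0 ≤ ((G.m i) e₀ : ℂ).re := slotMode_nonneg (G.lnk i) (G.pol i) B (G.m i) e₀
  have hpos : 0 < ((G.m i) e₀ : ℂ).re := lt_of_le_of_ne h0 (Ne.symm he₀)
  have hgap := sqrt_quarter_mul_sqrt_mode_le (G.lnk i) (G.pol i) B (G.m i) e₀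
  have hs : 0 < Real.sqrt ((G.m i) e₀ : ℂ).re := Real.sqrt_pos.2 hpos
  have hkey : Real.sqrt ((n : ℝ) / 4) ≤ Real.sqrt ((G.m i) e₀ : ℂ).re := by
    have : Real.sqrt ((n : ℝ) / 4) * Real.sqrt ((G.m i) e₀ : ℂ).re
        ≤ Real.sqrt ((G.m i) e₀ : ℂ).re * Real.sqrt ((G.m i) e₀ : ℂ).re := by
      rw [Real.mul_self_sqrt h0]; exact hgap
    exact le_of_mul_le_mul_right this hs
  refine hkey.trans ?_
  exact Finset.single_le_sum (f := fun e => G.wt i e) (fun e _ => G.wt_nonneg i e) (Finset.mem_univ e₀)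

/-- **Values are dominated by the total mass**: if dead data carry no coefficient,
`|G.func(ιU)| ≤ (n/4)^{-1/2} ∑ₑ N_G(e)`. [ours] -/
theorem Gen.abs_func_le (hn : n ≠ 0) (hz : ∀ i, G.cm i = 0 → G.z i = 0)
    (U : GaugeConfig d L (Matrix.specialUnitaryGroup (Fin n) ℂ)) :
    |G.func (WilsonFlow.coeConfig U)| ≤ (Real.sqrt ((n : ℝ) / 4))⁻¹ * ∑ e, G.mass e := by
  have hγ : 0 < Real.sqrt ((n : ℝ) / 4) :=
    Real.sqrt_pos.2 (div_pos (Nat.cast_pos.2 (Nat.pos_of_ne_zero hn)) four_pos)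
  -- `|func| ≤ ∑_{live} ν`
  have h1 : |G.func (WilsonFlow.coeConfig U)| ≤ ∑ i ∈ G.live, G.nu i := by
    refine (Finset.abs_sum_le_sum_abs _ _).trans ?_
    refine (Finset.sum_le_sum fun i _ => G.abs_term_le i U).trans (le_of_eq ?_)
    unfold Gen.live
    rw [Finset.sum_filter_of_ne]
    intro i _ hi hc
    apply hi
    unfold Gen.nu; rw [hz i hc, norm_zero, zero_mul]
  -- `ν ≤ γ⁻¹ ∑_e wt·ν` on live data
  have h2 : ∑ i ∈ G.live, G.nu i ≤ (Real.sqrt ((n : ℝ) / 4))⁻¹ * ∑ i ∈ G.live, ∑ e, G.wt i e * G.nu i := by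
    rw [Finset.mul_sum]
    refine Finset.sum_le_sum fun i hi => ?_
    rw [← Finset.sum_mul, ← mul_assoc]
    have h := G.sqrt_quarter_le_sum_wt hi
    have : 1 ≤ (Real.sqrt ((n : ℝ) / 4))⁻¹ * ∑ e, G.wt i e := by
      rw [inv_mul_eq_div, le_div_iff₀ hγ, one_mul]; exact h
    calc G.nu i = 1 * G.nu i := (one_mul _).symm
      _ ≤ (Real.sqrt ((n : ℝ) / 4))⁻¹ * (∑ e, G.wt i e) * G.nu i :=
          mul_le_mul_of_nonneg_right this (G.nu_nonneg i)
  refine h1.trans (h2.trans (le_of_eq ?_))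
  congr 1
  rw [Finset.sum_comm]
  rfl

end Values

/-- **Values of the graded series on `SU(n)^E`**: `|S̃^{(k)}(ιU)| ≤ (n/4)^{-1/2} · #E · N₀ · θ₁^k`
(extensive in the volume through `#E` only; rate `θ₁(d,n,B)`). [ours] -/
theorem abs_gradedSk_le (hn : n ≠ 0) (k : ℕ) (U : GaugeConfig d L (Matrix.specialUnitaryGroup (Fin n) ℂ)) :
    |gradedSk (d := d) (L := L) B k (WilsonFlow.coeConfig U)|
      ≤ (Real.sqrt ((n : ℝ) / 4))⁻¹ * (Fintype.card (Edge d L) : ℝ) * (N0 d n * theta1 d n B ^ k) := by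
  refine ((pack (d := d) (L := L) B k).G.abs_func_le hn (pack_z_eq_zero B k) U).trans ?_
  rw [mul_assoc]
  refine mul_le_mul_of_nonneg_left ?_ (inv_nonneg.2 (Real.sqrt_nonneg _))
  refine (Finset.sum_le_sum fun e _ => mass_pack_le B hn k e).trans (le_of_eq ?_)
  rw [Finset.sum_const, Finset.card_univ, nsmul_eq_mul]

/-- **Gradients of the graded series on `SU(n)^E`** (THEOREM A's domination, restated for `gradedSk`):
`|∂^a_e S̃^{(k)}(ιU)| ≤ N₀ θ₁^k`. [ours] -/
theorem abs_linkDeriv_gradedSk_le (hn : n ≠ 0) (k : ℕ)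
    (U : GaugeConfig d L (Matrix.specialUnitaryGroup (Fin n) ℂ)) (e : Edge d L) (a : B.ι) :
    |linkDeriv e (B.T a) (gradedSk (d := d) (L := L) B k) (WilsonFlow.coeConfig U)|
      ≤ N0 d n * theta1 d n B ^ k :=
  ((pack (d := d) (L := L) B k).G.abs_linkDeriv_func_le (pack_z_eq_zero B k) e a U).trans
    (mass_pack_le B hn k e)

section Second

variable {B}
variable {σ : Type} [Fintype σ] [DecidableEq σ] (G : Gen (d := d) (L := L) B σ)

omit [NeZero L] in
/-- **Repeated link derivative of a datum**: `∂^a_e ∂^a_e termF(z,x,y) = termF(z,x,T_a^{σ,e}(T_a^{σ,e} y))`,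
identically on the ambient space. [ours] -/
theorem Gen.linkDeriv_linkDeriv_term (i : G.I) (e : Edge d L) (a : B.ι) (W : AmbConfig d L n) :
    linkDeriv e (B.T a) (linkDeriv e (B.T a) (G.term i)) W =
      termF (G.lnk i) (G.pol i) (G.z i) (G.x i)
        (genCLM (G.lnk i) (G.pol i) e (B.T a) (genCLM (G.lnk i) (G.pol i) e (B.T a) (G.y i))) W := by
  have h1 : linkDeriv e (B.T a) (G.term i) =
      fun W' => -termF (G.lnk i) (G.pol i) (G.z i) (G.x i) (genCLM (G.lnk i) (G.pol i) e (B.T a) (G.y i)) W' :=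
    funext fun W' => linkDeriv_termF_skew (G.lnk i) (G.pol i) (G.z i) (G.x i) (G.y i) e (skew_T B a) W'
  rw [h1, linkDeriv_neg', linkDeriv_termF_skew _ _ _ _ _ e (skew_T B a), neg_neg]

omit [NeZero L] in
/-- **A repeated link derivative costs the mode**: `|∂^a_e∂^a_e termᵢ(ιU)| ≤ (mᵢ)_e νᵢ` (the generator
preserves the joint Casimir space, `genCLM_mem_jointSpace`, and costs `√((mᵢ)_e)` on it each time).
[ours] -/
theorem Gen.abs_linkDeriv_linkDeriv_term_le (i : G.I) (e : Edge d L) (a : B.ι)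
    (U : GaugeConfig d L (Matrix.specialUnitaryGroup (Fin n) ℂ)) :
    |linkDeriv e (B.T a) (linkDeriv e (B.T a) (G.term i)) (WilsonFlow.coeConfig U)|
      ≤ G.wt i e ^ 2 * G.nu i := by
  classical
  rw [G.linkDeriv_linkDeriv_term]
  set C := casimirFamily (G.lnk i) (G.pol i) B with hC
  set g := genCLM (G.lnk i) (G.pol i) e (B.T a) with hg
  have hy : G.y i ∈ jointSpace C (G.m i) := jointProj_apply_mem C (G.m i) (G.v i)
  have hgy : g (G.y i) ∈ jointSpace C (G.m i) := genCLM_mem_jointSpace _ _ B (G.m i) e (B.mem a) hy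
  -- `‖g w‖ ≤ √m ‖w‖` on the joint space
  have hcost : ∀ w ∈ jointSpace C (G.m i), ‖g w‖ ≤ Real.sqrt ((G.m i) e : ℂ).re * ‖w‖ := by
    intro w hw
    have h := norm_genCLM_jointProj_le (G.lnk i) (G.pol i) B (G.m i) e a w
    rwa [jointProj_eq_self_of_mem (G.m i) hw] at h
  have hgg : ‖g (g (G.y i))‖ ≤ ((G.m i) e : ℂ).re * ‖G.y i‖ := by
    have h0 : 0 ≤ ((G.m i) e : ℂ).re := slotMode_nonneg (G.lnk i) (G.pol i) B (G.m i) e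
    calc ‖g (g (G.y i))‖ ≤ Real.sqrt ((G.m i) e : ℂ).re * ‖g (G.y i)‖ := hcost _ hgy
      _ ≤ Real.sqrt ((G.m i) e : ℂ).re * (Real.sqrt ((G.m i) e : ℂ).re * ‖G.y i‖) :=
          mul_le_mul_of_nonneg_left (hcost _ hy) (Real.sqrt_nonneg _)
      _ = ((G.m i) e : ℂ).re * ‖G.y i‖ := by
          rw [← mul_assoc, Real.mul_self_sqrt h0]
  refine (abs_termF_coeConfig_le (G.lnk i) (G.pol i) (G.z i) (G.x i) _ U).trans ?_
  have hwt : G.wt i e ^ 2 = ((G.m i) e : ℂ).re := by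
    unfold Gen.wt; rw [Real.sq_sqrt (slotMode_nonneg (G.lnk i) (G.pol i) B (G.m i) e)]
  rw [hwt]
  unfold Gen.nu
  calc ‖G.z i‖ * ‖G.x i‖ * ‖g (g (G.y i))‖ ≤ ‖G.z i‖ * ‖G.x i‖ * (((G.m i) e : ℂ).re * ‖G.y i‖) :=
        mul_le_mul_of_nonneg_left hgg (by positivity)
    _ = ((G.m i) e : ℂ).re * (‖G.z i‖ * (‖G.x i‖ * ‖G.y i‖)) := by ring

/-- `∂^a_e∂^a_e G.func = ∑ᵢ ∂^a_e∂^a_e termᵢ` everywhere. [ours] -/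
theorem Gen.linkDeriv_linkDeriv_func (e : Edge d L) (a : B.ι) (W : AmbConfig d L n) :
    linkDeriv e (B.T a) (linkDeriv e (B.T a) G.func) W =
      ∑ i, linkDeriv e (B.T a) (linkDeriv e (B.T a) (G.term i)) W := by
  have h1 : linkDeriv e (B.T a) G.func = fun W' => ∑ i ∈ Finset.univ, linkDeriv e (B.T a) (G.term i) W' :=
    funext fun W' => G.linkDeriv_func e a W'
  rw [h1]
  have h := congrFun (linkDeriv_finset_sum e (B.T a) Finset.univ (fun i => linkDeriv e (B.T a) (G.term i))
    fun i _ => contDiff_linkDeriv (G.contDiff_term i) e (B.T a)) W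
  exact h

/-- **Repeated derivatives are dominated by (max weight) × mass**: if dead data carry no coefficient and
all weights at `e` are `≤ M`, then `|∂^a_e∂^a_e G.func(ιU)| ≤ M N_G(e)`. [ours] -/
theorem Gen.abs_linkDeriv_linkDeriv_func_le (hz : ∀ i, G.cm i = 0 → G.z i = 0) {e : Edge d L} {M : ℝ}
    (hM : ∀ i, G.wt i e ≤ M) (a : B.ι) (U : GaugeConfig d L (Matrix.specialUnitaryGroup (Fin n) ℂ)) :
    |linkDeriv e (B.T a) (linkDeriv e (B.T a) G.func) (WilsonFlow.coeConfig U)| ≤ M * G.mass e := by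
  rw [G.linkDeriv_linkDeriv_func]
  refine (Finset.abs_sum_le_sum_abs _ _).trans ?_
  have h1 : ∑ i, |linkDeriv e (B.T a) (linkDeriv e (B.T a) (G.term i)) (WilsonFlow.coeConfig U)|
      ≤ ∑ i, M * (G.wt i e * G.nu i) := by
    refine Finset.sum_le_sum fun i _ => (G.abs_linkDeriv_linkDeriv_term_le i e a U).trans ?_
    rw [sq, mul_assoc]
    exact mul_le_mul_of_nonneg_right (hM i) (mul_nonneg (G.wt_nonneg i e) (G.nu_nonneg i))
  refine h1.trans (le_of_eq ?_)
  rw [← Finset.mul_sum]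
  congr 1
  unfold Gen.mass Gen.live
  rw [Finset.sum_filter_of_ne]
  intro i _ hi hc
  apply hi
  have : G.nu i = 0 := by unfold Gen.nu; rw [hz i hc, norm_zero, zero_mul]
  rw [this, mul_zero]

end Second

/-- **Repeated link derivatives of the graded series on `SU(n)^E`**:
`|∂^a_e ∂^a_e S̃^{(k)}(ιU)| ≤ (k+1) τ_* · N₀ θ₁^k`. [ours] -/
theorem abs_linkDeriv_linkDeriv_gradedSk_le (hn : n ≠ 0) (k : ℕ)
    (U : GaugeConfig d L (Matrix.specialUnitaryGroup (Fin n) ℂ)) (e : Edge d L) (a : B.ι) :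
    |linkDeriv e (B.T a) (linkDeriv e (B.T a) (gradedSk (d := d) (L := L) B k)) (WilsonFlow.coeConfig U)|
      ≤ ((k : ℝ) + 1) * tauStar B * (N0 d n * theta1 d n B ^ k) := by
  refine ((pack (d := d) (L := L) B k).G.abs_linkDeriv_linkDeriv_func_le (pack_z_eq_zero B k)
    (fun i => wt_pack_le B k i e) a U).trans ?_
  exact mul_le_mul_of_nonneg_left (mass_pack_le B hn k e)
    (mul_nonneg (by positivity) (tauStar_nonneg B))

end GradedSeries

end Summit.Ventures.LatticeQCDFlow.TrivializingMaps

end
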